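import Summits.AtomisticToContinuum.HydrodynamicLimit.Theses.CollisionIsometryCLT
import Summits.AtomisticToContinuum.HydrodynamicLimit.Theses.StiffCollisionalRelaxation
import Summits.AtomisticToContinuum.HydrodynamicLimit.Theorems.CollisionalTransferLocality.Negative.DegenerateProfiles
import Literature.Analysis.FluidPDE.CollisionalTransferTimeDep
import Literature.Analysis.FluidPDE.CollisionalTransferFunctional

/-!
# `CollisionalTransferLocality` (stmt-AtomisticToContinuum-9518) — line `ward-bgy-contact-rigidity`

Crux (route `CollisionIsometryCLT`, rank 4; shared verbatim with `StiffCollisionalRelaxation` K2, see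
`Disproof.shared_verbatim`): w.h.p. under the local Gibbs law, uniformly in `τ ≤ t`, the Irving–Kirkwood
collisional residual `Cc(τ)` of the `(ψ, χ)`-tested momentum + energy balance equals
`∫₀^τ∫ (div ψ + ∇χ·ū) p_c(ρ̄, θ̄)`, `p_c = hsPressure σ ρ θ − ρθ = ρθ(Z(ρσ³) − 1)`.

## The line (idea card `Ideas/ward-bgy-contact-rigidity.md`; TRIAGE r1-1/2/3: pass, merge with
`ybg-rigidity-contact-value`)

"The clock without entropy." Two-scale Ward identities of the deterministic flow are FREE: for every mixed
position–velocity near-contact observable `A` of the blown-up (scale `(N+1)^{1/3}`, hard-core diameter `σ`)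
relative configuration around a root particle, `[A]₀^τ = ∫₀^τ (free streaming) + Σ_collisions (jumps)` is the
tree's balance law `HardSphereFlow.sub_eq_integral_add_collisionalTransfer`, and its left side is `O(1)` while
both right-side terms are `O((N+1)^{1/3})`. Read with the velocity weight `v_root · e` and fed the ORDER-2
velocity-moment chaos (K) near contact (the route engine's input, `stub_momentChaos`), these identities ARE the
weak hard-core Born–Green–Yvon hierarchy for the time-averaged blown-up empirical correlation measures
(`stub_wardBGY`: `MomentChaosAt → MicroBoundsAt → WeakBGYAt`, threshold-free — this is the card's lever and its
"First lemma" generalised from the pair-shell clock `CollisionJumpPairShell` of `Ideator2Sketch.lean` to all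
`n`-body tests; the in/out symmetry of a thin-shell passage converts the one-sided flux moment `(g·ω)₋²` into
`½ (g·ω)²`, which (K) evaluates to `θ̄`). The closing tool is RIGIDITY of the hard-core BGY hierarchy at low
density, split into two pure-statics stubs over Mathlib objects (reduced correlation families
`g n : (Fin n → ℝ³) → ℝ`, root at the origin):
* `stub_hardCoreBGYUniqueness` (R): a realizable, re-rooting-invariant, box-bounded hard-core family solving
  weak BGY for all `n`, with the Palm law of large numbers ("purity": no activity mixture — the triage's
  counterexample) at density `ρ`, `ρσ³ < η_R`, is UNIQUE (hard-core Gurevich–Suhov / KMS ⇒ canonical DLR ⇒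
  Gibbs mixture ⇒ purity ⇒ the low-activity Gibbs state, unique by the Kirkwood–Salsburg contraction,
  Ruelle1969 Thm 4.2.3). Diluteness buys uniqueness, not accuracy: no expansion of the dynamics, `χ(η)` exact.
* `stub_gibbsFamilyEOS` (E): such a family EXISTS at every small density and its thin-shell contact intensity
  is `ρ · 6(Z(ρσ³) − 1) · Ḡ` with the TREE's `Z = hsCompressibility` (KS existence + virial/pressure equation
  + ensemble equivalence for the `limsup` torus free energy: the (X3) debt of triage, explicit).
The passage between the finite-`N` world and the statics (`stub_bgyPassage`, the apparatus stub: space–time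
blow-ups, Young-measure fibres `(s, x) ↦ g^{s,x}`, realizability and box bounds from PACKING, purity from
two-block purity, BGY from `WeakBGYAt`, then R + E and (K) once more for the velocity weights) outputs the
Gibbs contact trace (thin-shell `(g·ω)₋²`-weighted statistics, trace and odd parts), and `stub_contactReadout`
(flux = trace, collision kinematics, midpoint Taylor, `sup_τ`, with the Irving–Kirkwood identity `Cc = Σ jumps`
proved inside) turns it into the crux's conclusion at `(σ, Φ)`.

KEY DESIGN POINT (answers TRIAGE r1-2's "competitors must sit inside Ruelle's Banach ball"): the dynamical side
only ever needs the deterministic PACKING box bound; the Kirkwood–Salsburg contraction is applied to GIBBS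
states (after BGY ⇒ DLR), whose correlation functions are Ruelle-bounded for free, and the threshold `η_R`
absorbs the packing constant — the crux grants `∃ σ₀`. Realizability (the family is a limit of factorial
moment densities of finite point clouds) closes the loophole that signed affine combinations of Gibbs families
satisfy every LINEAR constraint (BGY, symmetry, density) and can fake purity.

## Stubs (7; the only `sorry`s)
* `stub_momentChaos`            — (K): orders 2 and 3, `m`-body near-contact weights (XL; the dynamical bet,
                                   shared with the route engine 12949 and with every sibling line).
* `stub_microstructureBounds`   — chamber `c₁ ≤ ρ̄`, `ρ̄σ³ ≤ η₁` (∀ η₁ > 0), 6th velocity moment, squared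
                                   cumulative transfer, two-block purity (L; triage X2; the crux stands alone).
* `stub_wardBGY`                — free Ward identities + (K) ⇒ weak hard-core BGY residuals → 0 (M/L; NEW).
* `stub_hardCoreBGYUniqueness`  — statics R (L/XL; hard cores "the only relevant case left open",
                                   GenoveseSimonella2012; line-specific hardest).
* `stub_gibbsFamilyEOS`         — statics E incl. the pressure equation for the tree's `Z` (L; X3).
* `stub_bgyPassage`             — apparatus: WeakBGY + (K) + bounds + R + E ⇒ Gibbs contact trace (L/XL).
* `stub_contactReadout`         — Irving–Kirkwood identity + contact trace + bounds ⇒ the crux at `(σ, Φ)` (L).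
Composition `CollisionalTransferLocality_of`: `η₁ := min η_R η_E / 2`, `σ₀ := min σ_K σ_B ⊓ 1/2`, modus ponens.

Disproof.lean (cdisprove cycle 1): NO `_false_without_` theorem exists; `EquilibriumRung` is EOS-blind and no
stub here is an equilibrium statement about `Cc`; `collisionalPressure_sigma_zero` is respected (contact
intensity `6(Z(η) − 1) = O(η)`). Landed Negative lemmas (`Theorems/…/Negative/DegenerateProfiles.lean`,
imported): vacuity guards only — no stub is an instance they refute.
-/

noncomputable section

namespace Summit.AtomisticToContinuum.HydrodynamicLimit.Cruxes.CollisionalTransferLocality.WardBgyContactRigidity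

open scoped BigOperators Topology Classical MeasureTheory InnerProductSpace
open Filter Set Function MeasureTheory
open Literature.MathematicalPhysics.KineticTheory

/-! ## Abbreviations (finite-`N` vocabulary of the crux) -/

/-- Phase-space configurations of `N + 1` spheres on `𝕋³`. [folklore] -/
abbrev Cfg (N : ℕ) : Type := Literature.Analysis.FluidPDE.Config (N + 1) (Fin 3) T3

/-- Hard-sphere flows of `N + 1` spheres of diameter `hsDiameter σ N` on `𝕋³`. [folklore] -/
abbrev Flow (σ : ℝ) (N : ℕ) : Type :=
  Literature.Analysis.FluidPDE.HardSphereFlow (Literature.Analysis.FluidPDE.Torus.geometry (Fin 3))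
    (hsDiameter σ N) (N + 1)

/-- A flow for every particle number (the crux's `Φ`). [folklore] -/
abbrev Flows (σ : ℝ) : Type := (N : ℕ) → Flow σ N

/-- Continuous positive profiles (the crux's standing hypotheses on `(a₀, θ₀, u₀)`). [folklore] -/
def NiceProfiles (a₀ θ₀ : T3 → ℝ) (u₀ : T3 → V3) : Prop :=
  Continuous a₀ ∧ Continuous θ₀ ∧ Continuous u₀ ∧ (∀ x, 0 < a₀ x) ∧ (∀ x, 0 < θ₀ x)

/-- Admissible kernel family at mesoscale `(N+1)^{-γ}` (verbatim the crux's six conditions). [folklore] -/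
def AdmissibleKernel (γ C : ℝ) (φ : ℕ → T3 → ℝ) : Prop :=
  (∀ N, Literature.Analysis.FunctionSpaces.Torus.IsSmooth (φ N)) ∧ (∀ N y, 0 ≤ φ N y) ∧ (∀ N, ∫ y, φ N y = 1) ∧
    (∀ (N : ℕ) y, ((N : ℝ) + 1) ^ (-γ) ≤ Literature.Analysis.FluidPDE.Torus.euclidDist y 0 → φ N y = 0) ∧
    (∀ (N : ℕ) y, φ N y ≤ C * ((N : ℝ) + 1) ^ (3 * γ)) ∧
    (∀ (N : ℕ) y, ‖Literature.Analysis.FunctionSpaces.Torus.gradient (φ N) y‖ ≤ C * ((N : ℝ) + 1) ^ (4 * γ))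

/-- Block density `ρ̄(x)` (kernel `φ_N` centred at `x`). [folklore] -/
def rhoB (φ : ℕ → T3 → ℝ) (N : ℕ) (z : Cfg N) (x : T3) : ℝ :=
  empiricalDensityField z (fun y => φ N (y - x))

/-- Block momentum `m̄(x)`. [folklore] -/
def momB (φ : ℕ → T3 → ℝ) (N : ℕ) (z : Cfg N) (x : T3) : V3 :=
  empiricalMomentumField z (fun y => φ N (y - x))

/-- Block energy `Ē(x)`. [folklore] -/
def enB (φ : ℕ → T3 → ℝ) (N : ℕ) (z : Cfg N) (x : T3) : ℝ :=
  empiricalEnergyField z (fun y => φ N (y - x))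

/-- Block velocity `ū = m̄/ρ̄` (junk `0` on empty blocks). [folklore] -/
def velB (φ : ℕ → T3 → ℝ) (N : ℕ) (z : Cfg N) (x : T3) : V3 :=
  (rhoB φ N z x)⁻¹ • momB φ N z x

/-- Block temperature `θ̄ = (2/3)(Ē/ρ̄ − |m̄|²/(2ρ̄²))`. [folklore] -/
def thetaB (φ : ℕ → T3 → ℝ) (N : ℕ) (z : Cfg N) (x : T3) : ℝ :=
  2 / 3 * (enB φ N z x / rhoB φ N z x - ‖momB φ N z x‖ ^ 2 / (2 * rhoB φ N z x ^ 2))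

/-- Blow-up factor `(N+1)^{1/3}`: blown-up lengths make the hard-core diameter equal to `σ`. [folklore] -/
def blowup (N : ℕ) : ℝ := ((N : ℝ) + 1) ^ ((1 : ℝ) / 3)

/-- Blown-up position of particle `j` RELATIVE to particle `i` (nearest torus image). [folklore] -/
def rel (N : ℕ) (z : Cfg N) (i j : Fin (N + 1)) : V3 :=
  blowup N • Literature.Analysis.FluidPDE.Torus.reprSym ((z j).1 - (z i).1)

/-- Unit vector along `r` (junk `0` at `r = 0`). [folklore] -/
def unitVec (r : V3) : V3 := ‖r‖⁻¹ • r

/-- Indicator of the thin shell `σ < |r| ≤ σ(1 + h)` (blown-up units). [folklore] -/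
def shellInd (σ h : ℝ) (r : V3) : ℝ := if σ < ‖r‖ ∧ ‖r‖ ≤ σ * (1 + h) then 1 else 0

/-- Uniform average of `G` over directions, written radially against the rotation-invariant density
`localMaxwellian 1 1 0`. [folklore] -/
def dirAvg (G : V3 → ℝ) : ℝ :=
  ∫ n : V3, G (unitVec n) * Literature.Analysis.FluidPDE.localMaxwellian 1 1 (0 : V3) n

/-! ## (K) velocity-moment chaos near contact: statistics of orders 2 and 3 -/

/-- Weight of the ordered `m`-tuple `j` of distinct non-root neighbours of the root `i`: macroscopic
localisation `χ(x_i)` times a test `W` of the blown-up relative positions. [folklore] -/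
def tupleWt (N m : ℕ) (W : (Fin m → V3) → ℝ) (χ : T3 → ℝ) (z : Cfg N) (i : Fin (N + 1))
    (j : Fin m ↪ Fin (N + 1)) : ℝ :=
  if ∀ k, j k ≠ i then χ (z i).1 * W (fun k => rel N z i (j k)) else 0

/-- Slots of the tagged `(m+1)`-tuple: slot `0` is the root `i`, slot `k+1` is `j k`. [folklore] -/
def slot (N m : ℕ) (i : Fin (N + 1)) (j : Fin m ↪ Fin (N + 1)) : Fin (m + 1) → Fin (N + 1) :=
  Matrix.vecCons i (fun k => j k)

/-- Order-2 statistic: weighted particle average of `(v_{k₀} − ū)_a (v_{k₁} − ū)_b − θ̄ δ_{k₀k₁} δ_{ab}`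
(velocities centred at the block velocity at the root). [folklore] -/
def S2 (φ : ℕ → T3 → ℝ) (N m : ℕ) (W : (Fin m → V3) → ℝ) (χ : T3 → ℝ) (z : Cfg N)
    (k₀ k₁ : Fin (m + 1)) (a b : Fin 3) : ℝ :=
  ((N : ℝ) + 1)⁻¹ * ∑ i : Fin (N + 1), ∑ j : (Fin m ↪ Fin (N + 1)), tupleWt N m W χ z i j *
    (((z (slot N m i j k₀)).2 a - velB φ N z (z i).1 a) * ((z (slot N m i j k₁)).2 b - velB φ N z (z i).1 b) -
      (if k₀ = k₁ ∧ a = b then thetaB φ N z (z i).1 else 0))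

/-- Order-3 statistic: weighted particle average of the product of three centred velocity components.
[folklore] -/
def S3 (φ : ℕ → T3 → ℝ) (N m : ℕ) (W : (Fin m → V3) → ℝ) (χ : T3 → ℝ) (z : Cfg N)
    (k₀ k₁ k₂ : Fin (m + 1)) (a b c : Fin 3) : ℝ :=
  ((N : ℝ) + 1)⁻¹ * ∑ i : Fin (N + 1), ∑ j : (Fin m ↪ Fin (N + 1)), tupleWt N m W χ z i j *
    (((z (slot N m i j k₀)).2 a - velB φ N z (z i).1 a) * ((z (slot N m i j k₁)).2 b - velB φ N z (z i).1 b) *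
      ((z (slot N m i j k₂)).2 c - velB φ N z (z i).1 c))

/-- **(K) at `(σ, Φ)`**: for every admissible kernel family, every `m`, every continuous compactly supported
configurational weight `W` (contact shell included) and localisation `χ`, the time-integrated order-2 statistics
tend to `0` in probability with the Maxwellian value `θ̄ δδ` subtracted, and the order-3 statistics tend to `0`.
Unconditional (no forest conditioning, triage r1-2 remark 2). [folklore] -/
def MomentChaosAt (σ : ℝ) (a₀ θ₀ : T3 → ℝ) (u₀ : T3 → V3) (Φ : Flows σ) : Prop :=
  ∀ (γ C : ℝ) (φ : ℕ → T3 → ℝ), 0 < γ → γ ≤ 1 / 15 → AdmissibleKernel γ C φ →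
    ∀ (m : ℕ) (W : (Fin m → V3) → ℝ) (χ : T3 → ℝ), Continuous W → HasCompactSupport W → (∀ r, |W r| ≤ 1) →
      Continuous χ → (∀ x, |χ x| ≤ 1) → ∀ t : ℝ, 0 < t → ∀ δ : ℝ, 0 < δ →
        (∀ (k₀ k₁ : Fin (m + 1)) (a b : Fin 3), Tendsto (fun N : ℕ => localGibbsLaw σ a₀ u₀ θ₀ N (Φ N)
          {z | δ < |∫ s in Icc 0 t, S2 φ N m W χ ((Φ N).flow s z) k₀ k₁ a b|}) atTop (𝓝 0)) ∧
        (∀ (k₀ k₁ k₂ : Fin (m + 1)) (a b c : Fin 3), Tendsto (fun N : ℕ => localGibbsLaw σ a₀ u₀ θ₀ N (Φ N)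
          {z | δ < |∫ s in Icc 0 t, S3 φ N m W χ ((Φ N).flow s z) k₀ k₁ k₂ a b c|}) atTop (𝓝 0))

/-! ## A-priori microstructure bounds along the flow -/

/-- Number of neighbours of `i` within blown-up distance `R`. [folklore] -/
def nbCount (N : ℕ) (z : Cfg N) (i : Fin (N + 1)) (R : ℝ) : ℝ :=
  ∑ j : Fin (N + 1), if j ≠ i ∧ ‖rel N z i j‖ ≤ R then (1 : ℝ) else 0

/-- Cumulative momentum transfer of each particle on `(0, t]`: `X_i = Σ_{collisions of i} ε ‖Δv_i‖`
(each `O(1)`: `≍ t (N+1)^{1/3} σ² √θ` collisions of size `σ (N+1)^{-1/3} √θ`). [folklore] -/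
def cumTransfer (σ : ℝ) (N : ℕ) (Φ : Flow σ N) (z : Cfg N) (t : ℝ) : Fin (N + 1) → ℝ :=
  Φ.collisionalTransferFunctional
    (fun (i : Fin (N + 1)) (_ : Fin (N + 1)) (pre post : Cfg N) =>
      (Pi.single i (hsDiameter σ N * ‖(post i).2 - (pre i).2‖) : Fin (N + 1) → ℝ)) z t

/-- **Microstructure bounds at `(σ, Φ)` with density ceiling `η₁`**: for every admissible kernel family and
`t > 0`: (B0) block chamber — w.h.p. no block emptier than `c₁` or denser than `η₁/σ³` on `[0, t]`; (B1) the
time-integrated 6th velocity moment is bounded w.h.p.; (B2) the particle average of `X_i²` is bounded w.h.p.;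
(B3) TWO-BLOCK PURITY — for every `δ` and all large `R`, the neighbour count within blown-up radius `R` over
`(4π/3)R³` equals the block density at the particle up to `δ` in time-integrated mean square. [folklore] -/
def MicroBoundsAt (σ η₁ : ℝ) (a₀ θ₀ : T3 → ℝ) (u₀ : T3 → V3) (Φ : Flows σ) : Prop :=
  ∀ (γ C : ℝ) (φ : ℕ → T3 → ℝ), 0 < γ → γ ≤ 1 / 15 → AdmissibleKernel γ C φ → ∀ t : ℝ, 0 < t →
    (∃ c₁ : ℝ, 0 < c₁ ∧ Tendsto (fun N : ℕ => localGibbsLaw σ a₀ u₀ θ₀ N (Φ N)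
      {z | ∃ s ∈ Icc 0 t, ∃ x : T3, rhoB φ N ((Φ N).flow s z) x < c₁ ∨
        η₁ < rhoB φ N ((Φ N).flow s z) x * σ ^ 3}) atTop (𝓝 0)) ∧
    (∃ K : ℝ, Tendsto (fun N : ℕ => localGibbsLaw σ a₀ u₀ θ₀ N (Φ N)
      {z | K < ∫ s in Icc 0 t, ∫ y, ‖y.2‖ ^ 6 ∂(Literature.Analysis.FluidPDE.empiricalMeasure ((Φ N).flow s z))})
      atTop (𝓝 0)) ∧
    (∃ K : ℝ, Tendsto (fun N : ℕ => localGibbsLaw σ a₀ u₀ θ₀ N (Φ N)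
      {z | K < ((N : ℝ) + 1)⁻¹ * ∑ i : Fin (N + 1), (cumTransfer σ N (Φ N) z t i) ^ 2}) atTop (𝓝 0)) ∧
    (∀ δ : ℝ, 0 < δ → ∃ R₀ : ℝ, 0 < R₀ ∧ ∀ R : ℝ, R₀ ≤ R → Tendsto (fun N : ℕ => localGibbsLaw σ a₀ u₀ θ₀ N (Φ N)
      {z | δ < ∫ s in Icc 0 t, ((N : ℝ) + 1)⁻¹ * ∑ i : Fin (N + 1),
        (nbCount N ((Φ N).flow s z) i R / (4 / 3 * Real.pi * R ^ 3) -
          rhoB φ N ((Φ N).flow s z) (((Φ N).flow s z) i).1) ^ 2}) atTop (𝓝 0))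

/-! ## Weak hard-core BGY: finite-`N` residuals (the Ward identities' output) -/

/-- Open admissible set of `n` reduced (root-relative, blown-up) positions: no overlap with the root at the
origin and none pairwise. [folklore] -/
def redAdm (σ : ℝ) (n : ℕ) : Set (Fin n → V3) :=
  {Y | (∀ k, σ < ‖Y k‖) ∧ ∀ k l, k ≠ l → σ < ‖Y k - Y l‖}

/-- BGY test functions of `n` reduced positions: `C¹`, compactly supported INSIDE the open admissible set
(so internal contact terms vanish). [folklore] -/
def IsBGYTest (σ : ℝ) (n : ℕ) (F : (Fin n → V3) → ℝ) : Prop :=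
  ContDiff ℝ 1 F ∧ HasCompactSupport F ∧ tsupport F ⊆ redAdm σ n

/-- The reduced configuration of the tuple `j` seen from the root `i`. [folklore] -/
def redCfg (N n : ℕ) (z : Cfg N) (i : Fin (N + 1)) (j : Fin n ↪ Fin (N + 1)) : Fin n → V3 :=
  fun k => rel N z i (j k)

/-- Root weight `χ(x_i) θ̄(x_i)` of an admissible (root-avoiding) tuple, else `0`. The factor `θ̄` is what the
Ward identity with velocity weight `v_i · e` produces under (K). [folklore] -/
def rootWt (φ : ℕ → T3 → ℝ) (N n : ℕ) (χ : T3 → ℝ) (z : Cfg N) (i : Fin (N + 1))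
    (j : Fin n ↪ Fin (N + 1)) : ℝ :=
  if ∀ k, j k ≠ i then χ (z i).1 * thetaB φ N z (z i).1 else 0

/-- **Root-variable BGY residual** at shell width `h`: particle average over roots `i` and tuples `j` of
`−Σ_k ∂_{k,e}F(Y) − (hσ)⁻¹ Σ_{p ∉ tuple} F(Y) 1{σ < |y_p| ≤ σ(1+h)} (ŷ_p · e)` (moving the root moves every
reduced coordinate by `−e`; the shell term counts outsiders at contact with the root). Limit form:
`−∫ (Σ_k ∂_{k,e}F) g_n = lim_h (hσ)⁻¹ ∫ F(Y) 1_shell(y) (ŷ·e) g_{n+1}(Y, y)`. [folklore] -/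
def bgyResRoot (σ h : ℝ) (φ : ℕ → T3 → ℝ) (N n : ℕ) (F : (Fin n → V3) → ℝ) (χ : T3 → ℝ) (e : V3)
    (z : Cfg N) : ℝ :=
  ((N : ℝ) + 1)⁻¹ * ∑ i : Fin (N + 1), ∑ j : (Fin n ↪ Fin (N + 1)), rootWt φ N n χ z i j *
    (-(∑ k : Fin n, fderiv ℝ F (redCfg N n z i j) (Pi.single k e)) -
      (h * σ)⁻¹ * ∑ p : Fin (N + 1), (if p ≠ i ∧ (∀ k, j k ≠ p) then
        F (redCfg N n z i j) * shellInd σ h (rel N z i p) * ⟪unitVec (rel N z i p), e⟫_ℝ else 0))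

/-- **`k`-variable BGY residual** at shell width `h`:
`∂_{k,e}F(Y) − (hσ)⁻¹ Σ_{p ∉ tuple} F(Y) 1{σ < |y_p − y_k| ≤ σ(1+h)} (unit(y_p − y_k) · e)`. Limit form:
`∫ ∂_{k,e}F g_n = lim_h (hσ)⁻¹ ∫ F(Y) 1_shell(y − y_k) (unit(y − y_k)·e) g_{n+1}(Y, y)`. [folklore] -/
def bgyResAt (σ h : ℝ) (φ : ℕ → T3 → ℝ) (N n : ℕ) (F : (Fin n → V3) → ℝ) (χ : T3 → ℝ) (e : V3)
    (k : Fin n) (z : Cfg N) : ℝ :=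
  ((N : ℝ) + 1)⁻¹ * ∑ i : Fin (N + 1), ∑ j : (Fin n ↪ Fin (N + 1)), rootWt φ N n χ z i j *
    (fderiv ℝ F (redCfg N n z i j) (Pi.single k e) -
      (h * σ)⁻¹ * ∑ p : Fin (N + 1), (if p ≠ i ∧ (∀ k', j k' ≠ p) then
        F (redCfg N n z i j) * shellInd σ h (rel N z i p - rel N z i (j k)) *
          ⟪unitVec (rel N z i p - rel N z i (j k)), e⟫_ℝ else 0))

/-- **Weak hard-core BGY at `(σ, Φ)`** (finite-`N`, `θ̄`-weighted, thin-shell form): for every admissible kernel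
family, every `n`, BGY test `F`, localisation `χ`, direction `e`, `t`, `δ`, there is `h₀` such that for
`0 < h < h₀` the time-integrated root- and `k`-variable residuals are `≤ δ` in probability as `N → ∞`.
[folklore] -/
def WeakBGYAt (σ : ℝ) (a₀ θ₀ : T3 → ℝ) (u₀ : T3 → V3) (Φ : Flows σ) : Prop :=
  ∀ (γ C : ℝ) (φ : ℕ → T3 → ℝ), 0 < γ → γ ≤ 1 / 15 → AdmissibleKernel γ C φ →
    ∀ (n : ℕ) (F : (Fin n → V3) → ℝ) (χ : T3 → ℝ) (e : V3), IsBGYTest σ n F → Continuous χ →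
      (∀ x, |χ x| ≤ 1) → ‖e‖ ≤ 1 → ∀ t : ℝ, 0 < t → ∀ δ : ℝ, 0 < δ → ∃ h₀ : ℝ, 0 < h₀ ∧ ∀ h : ℝ, 0 < h →
        h < h₀ →
        Tendsto (fun N : ℕ => localGibbsLaw σ a₀ u₀ θ₀ N (Φ N)
          {z | δ < |∫ s in Icc 0 t, bgyResRoot σ h φ N n F χ e ((Φ N).flow s z)|}) atTop (𝓝 0) ∧
        ∀ k : Fin n, Tendsto (fun N : ℕ => localGibbsLaw σ a₀ u₀ θ₀ N (Φ N)
          {z | δ < |∫ s in Icc 0 t, bgyResAt σ h φ N n F χ e k ((Φ N).flow s z)|}) atTop (𝓝 0)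

/-! ## Statics: reduced hard-core BGY families on `ℝ³` (root at the origin)

`g n : (Fin n → ℝ³) → ℝ` plays the rôle of the reduced `(n+1)`-point correlation function `ρ_{n+1}(0, ·)` of a
translation-invariant point process of hard spheres of diameter `σ` at density `dens` (`g 0 = dens`,
`g 1 y = ρ_2(0, y)`, …). -/

/-- **Hard-core BGY family** (the competitor class of the rigidity theorem). Fields: measurability,
nonnegativity, local integrability with the BOX (Ruelle-type) bound `∫_{unit boxes} g_n ≤ ξ^{n+1}` (any `ξ`:
on the dynamical side it is the deterministic PACKING constant), symmetry in the `n` non-root particles,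
RE-ROOTING invariance (`g_n` comes from a symmetric translation-invariant `ρ_{n+1}`), hard-core support,
density `g_0 = dens`, the weak hard-core BGY identities for all `n` in the root and in each particle variable
(thin-shell limit form, tests supported inside the open admissible set), PURITY as the Palm law of large
numbers `liminf_R E⁰[(n(B_R)/|B_R| − dens)²] = 0` written in `(g_1, g_2)` (excludes activity mixtures, TRIAGE
r1-1), and REALIZABILITY: `dens⁻¹ g_n` are limits of the factorial moment densities of finite random point
clouds (closes the signed-affine-combination loophole; automatic for limits of empirical measures). [folklore] -/
structure IsHardCoreBGYFamily (σ ξ dens : ℝ) (g : (n : ℕ) → (Fin n → V3) → ℝ) : Prop where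
  measurable : ∀ n, Measurable (g n)
  nonneg : ∀ n Y, 0 ≤ g n Y
  locInt : ∀ (n : ℕ) (c : Fin n → V3), IntegrableOn (g n) (Set.pi Set.univ fun k => Metric.closedBall (c k) 1)
  boxBound : ∀ (n : ℕ) (c : Fin n → V3),
    (∫ Y in Set.pi Set.univ (fun k => Metric.closedBall (c k) 1), g n Y) ≤ ξ ^ (n + 1)
  symm : ∀ (n : ℕ) (π : Equiv.Perm (Fin n)) (Y : Fin n → V3), g n (Y ∘ π) = g n Y
  reroot : ∀ (n : ℕ) (Y : Fin (n + 1) → V3),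
    g (n + 1) (Matrix.vecCons (-Y 0) (fun k : Fin n => Y k.succ - Y 0)) = g (n + 1) Y
  hardCore : ∀ (n : ℕ) (Y : Fin n → V3),
    ((∃ k, ‖Y k‖ < σ) ∨ ∃ k l, k ≠ l ∧ ‖Y k - Y l‖ < σ) → g n Y = 0
  density : ∀ Y : Fin 0 → V3, g 0 Y = dens
  bgyRoot : ∀ (n : ℕ) (F : (Fin n → V3) → ℝ) (e : V3), IsBGYTest σ n F →
    Tendsto (fun h : ℝ => -(∫ Y, (∑ k : Fin n, fderiv ℝ F Y (Pi.single k e)) * g n Y) -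
      (h * σ)⁻¹ * ∫ Yy : Fin (n + 1) → V3,
        F (Fin.tail Yy) * shellInd σ h (Yy 0) * ⟪unitVec (Yy 0), e⟫_ℝ * g (n + 1) Yy) (𝓝[>] 0) (𝓝 0)
  bgyAt : ∀ (n : ℕ) (F : (Fin n → V3) → ℝ) (e : V3) (k : Fin n), IsBGYTest σ n F →
    Tendsto (fun h : ℝ => (∫ Y, fderiv ℝ F Y (Pi.single k e) * g n Y) -
      (h * σ)⁻¹ * ∫ Yy : Fin (n + 1) → V3,
        F (Fin.tail Yy) * shellInd σ h (Yy 0 - Yy k.succ) * ⟪unitVec (Yy 0 - Yy k.succ), e⟫_ℝ * g (n + 1) Yy)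
      (𝓝[>] 0) (𝓝 0)
  purity : ∀ ε : ℝ, 0 < ε → ∀ R₀ : ℝ, ∃ R : ℝ, R₀ ≤ R ∧
    |(∫ Y in Set.pi Set.univ (fun _ : Fin 2 => Metric.closedBall (0 : V3) R), g 2 Y) /
          (dens * (4 / 3 * Real.pi * R ^ 3) ^ 2) +
        (∫ y in Metric.closedBall (0 : V3) R, g 1 ![y]) / (dens * (4 / 3 * Real.pi * R ^ 3) ^ 2) -
        2 * (∫ y in Metric.closedBall (0 : V3) R, g 1 ![y]) / (4 / 3 * Real.pi * R ^ 3) + dens ^ 2| ≤ ε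
  realizable : ∃ (M : ℕ → ℕ) (P : (k : ℕ) → Measure (Fin (M k) → V3)), (∀ k, IsProbabilityMeasure (P k)) ∧
    ∀ (n : ℕ) (F : (Fin n → V3) → ℝ), Continuous F → HasCompactSupport F →
      Tendsto (fun k : ℕ => ∫ X, (∑ j : (Fin n ↪ Fin (M k)), F (fun l => X (j l))) ∂(P k)) atTop
        (𝓝 (dens⁻¹ * ∫ Y, F Y * g n Y))

/-- **R — hard-core BGY uniqueness below `η_R`**: two hard-core BGY families (any box constants) with the same
diameter and the same density `dens`, `dens σ³ < η_R`, coincide a.e. at every level. [folklore] -/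
def HardCoreBGYUniqueness (ηR : ℝ) : Prop :=
  ∀ (σ ξ ξ' dens : ℝ) (g g' : (n : ℕ) → (Fin n → V3) → ℝ), 0 < σ → 0 < dens → dens * σ ^ 3 < ηR →
    IsHardCoreBGYFamily σ ξ dens g → IsHardCoreBGYFamily σ ξ' dens g' → ∀ n, g n =ᵐ[volume] g' n

/-- **E — the Gibbs family and its equation of state below `η_E`**: at every diameter `σ` and density `dens` with
`dens σ³ < η_E` there is a hard-core BGY family whose thin-shell contact intensity (per unit volume, direction
weight `G`) is `dens · 6 (Z(dens σ³) − 1) · Ḡ`, `Z = hsCompressibility` (the tree's `1 + η f_ex'(η)` from the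
`limsup` torus free energy) — i.e. `4π η g(σ⁺) = 6(Z(η) − 1)`, isotropic. [folklore] -/
def GibbsFamilyEOS (ηE : ℝ) : Prop :=
  ∀ (σ dens : ℝ), 0 < σ → 0 < dens → dens * σ ^ 3 < ηE →
    ∃ (ξ : ℝ) (g : (n : ℕ) → (Fin n → V3) → ℝ), IsHardCoreBGYFamily σ ξ dens g ∧
      ∀ G : V3 → ℝ, Continuous G → (∀ r, |G r| ≤ 1) →
        Tendsto (fun h : ℝ => h⁻¹ * ∫ y : V3, shellInd σ h y * G (unitVec y) * g 1 ![y]) (𝓝[>] 0)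
          (𝓝 (dens * (6 * (hsCompressibility (dens * σ ^ 3) - 1)) * dirAvg G))

/-! ## The Gibbs contact trace (thin-shell flux statistics along the flow) -/

/-- Negative part of the relative normal velocity of the pair `(i, j)` along `ω̂_ij = unit(x_i − x_j)`
(approaching pairs). [folklore] -/
def gneg (N : ℕ) (z : Cfg N) (i j : Fin (N + 1)) : ℝ :=
  min (⟪(z i).2 - (z j).2, unitVec (rel N z j i)⟫_ℝ) 0

/-- Trace statistic: `(N+1)⁻¹ Σ_{i≠j} χ(x_i) 1{shell_h}(i,j) ((v_i − v_j)·ω̂)₋² G(ω̂_ij, ū(x_i))`. [folklore] -/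
def TrStat (σ h : ℝ) (φ : ℕ → T3 → ℝ) (N : ℕ) (G : V3 → V3 → ℝ) (χ : T3 → ℝ) (z : Cfg N) : ℝ :=
  ((N : ℝ) + 1)⁻¹ * ∑ i : Fin (N + 1), ∑ j : Fin (N + 1), (if j ≠ i then
    χ (z i).1 * shellInd σ h (rel N z i j) * (gneg N z i j) ^ 2 * G (unitVec (rel N z j i)) (velB φ N z (z i).1)
    else 0)

/-- Odd statistic: the trace statistic with the extra factor `(v_i + v_j − 2ū(x_i))_b`. [folklore] -/
def OdStat (σ h : ℝ) (φ : ℕ → T3 → ℝ) (N : ℕ) (G : V3 → V3 → ℝ) (χ : T3 → ℝ) (z : Cfg N) (b : Fin 3) : ℝ :=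
  ((N : ℝ) + 1)⁻¹ * ∑ i : Fin (N + 1), ∑ j : Fin (N + 1), (if j ≠ i then
    χ (z i).1 * shellInd σ h (rel N z i j) * (gneg N z i j) ^ 2 * G (unitVec (rel N z j i)) (velB φ N z (z i).1) *
      ((z i).2 b + (z j).2 b - 2 * velB φ N z (z i).1 b)
    else 0)

/-- Direction average of `G(·, u)`. [folklore] -/
def dirAvg₂ (G : V3 → V3 → ℝ) (u : V3) : ℝ := dirAvg (fun n => G n u)

/-- **Gibbs contact trace at `(σ, Φ)`**: for every admissible kernel family, continuous weight `G(ω, ū)` with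
`|G| ≤ 1 + ‖ū‖`, localisation `χ`, `t`, `δ`, for all small `h`: (trace)
`h⁻¹ ∫₀ᵗ TrStat → ∫₀ᵗ∫ χ ρ̄ θ̄ · 6(Z(ρ̄σ³) − 1) · Ḡ(ū)` in probability — contact density with the exact `χ(η)`
to all orders, isotropic normals, de-fluxed normal second moment `θ̄` —, and (odd) `h⁻¹ ∫₀ᵗ OdStat → 0`
(no flux-weighted odd third moment: no collisional heat flux). [folklore] -/
def GibbsContactTraceAt (σ : ℝ) (a₀ θ₀ : T3 → ℝ) (u₀ : T3 → V3) (Φ : Flows σ) : Prop :=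
  ∀ (γ C : ℝ) (φ : ℕ → T3 → ℝ), 0 < γ → γ ≤ 1 / 15 → AdmissibleKernel γ C φ →
    ∀ (G : V3 → V3 → ℝ) (χ : T3 → ℝ), Continuous (Function.uncurry G) → (∀ n u, |G n u| ≤ 1 + ‖u‖) →
      Continuous χ → (∀ x, |χ x| ≤ 1) → ∀ t : ℝ, 0 < t → ∀ δ : ℝ, 0 < δ → ∃ h₀ : ℝ, 0 < h₀ ∧ ∀ h : ℝ,
        0 < h → h < h₀ →
        Tendsto (fun N : ℕ => localGibbsLaw σ a₀ u₀ θ₀ N (Φ N)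
          {z | δ < |h⁻¹ * (∫ s in Icc 0 t, TrStat σ h φ N G χ ((Φ N).flow s z)) -
            ∫ s in Icc 0 t, ∫ x, χ x * (rhoB φ N ((Φ N).flow s z) x * thetaB φ N ((Φ N).flow s z) x *
              (6 * (hsCompressibility (rhoB φ N ((Φ N).flow s z) x * σ ^ 3) - 1))) *
              dirAvg₂ G (velB φ N ((Φ N).flow s z) x)|}) atTop (𝓝 0) ∧
        ∀ b : Fin 3, Tendsto (fun N : ℕ => localGibbsLaw σ a₀ u₀ θ₀ N (Φ N)
          {z | δ < |h⁻¹ * ∫ s in Icc 0 t, OdStat σ h φ N G χ ((Φ N).flow s z) b|}) atTop (𝓝 0)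

/-! ## The crux's conclusion at fixed `(σ, a₀, θ₀, u₀, Φ)` (verbatim tail of the route decl) -/

/-- The conclusion of `CollisionalTransferLocality` at fixed `(σ, a₀, θ₀, u₀)` AND fixed flow family `Φ`: the
text of the route decl after `∀ Φ …,`, verbatim, so that the crux is definitionally
`∀ profiles … ∃ σ₀ … ∀ σ … ∀ Φ, ConclusionFor σ a₀ θ₀ u₀ Φ` (`crux_iff`). [folklore] -/
def ConclusionFor (σ : ℝ) (a₀ θ₀ : T3 → ℝ) (u₀ : T3 → V3) (Φ : Flows σ) : Prop :=
  ∀ (γ C : ℝ) (φ : ℕ → (UnitAddTorus (Fin 3)) → ℝ), 0 < γ → γ ≤ 1 / 15 → ((∀ N, Literature.Analysis.FunctionSpaces.Torus.IsSmooth (φ N)) ∧ (∀ N y, 0 ≤ φ N y) ∧ (∀ N, ∫ y, φ N y = 1) ∧ (∀ (N : ℕ) y, ((N : ℝ) + 1) ^ (-γ) ≤ Literature.Analysis.FluidPDE.Torus.euclidDist y 0 → φ N y = 0) ∧ (∀ (N : ℕ) y, φ N y ≤ C * ((N : ℝ) + 1) ^ (3 * γ)) ∧ (∀ (N : ℕ)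 y, ‖Literature.Analysis.FunctionSpaces.Torus.gradient (φ N) y‖ ≤ C * ((N : ℝ) + 1) ^ (4 * γ))) → let ρb := fun (N : ℕ) (z : Literature.Analysis.FluidPDE.Config (N + 1) (Fin 3) (UnitAddTorus (Fin 3))) (x : (UnitAddTorus (Fin 3))) => Literature.MathematicalPhysics.KineticTheory.empiricalDensityField z (fun y => φ N (y - x)); let mb := fun (N : ℕ) (z : Literature.Analysis.FluidPDE.Config (N + 1) (Fin 3) (UnitAddTorus (Fin 3))) (x : (UnitAddTorus (Fin 3))) => Literature.MathematicalPhysics.KineticTheory.empiricalMomentumField z (fun y => φ N (y - x)); let Eb := fun (N : ℕ) (z : Literature.Analysis.FluidPDE.Config (N + 1) (Fin 3) (UnitAddTorus (Fin 3))) (x : (UnitAddTorus (Fin 3))) => Literature.MathematicalPhysics.KineticTheory.empiricalEnergyField z (fun y => φ N (y - x)); let ub := fun (N : ℕ) (z : Literature.Analysis.FluidPDE.Config (N + 1) (Fin 3) (UnitAddTorus (Fin 3))) (x : (UnitAddTorus (Fin 3))) => (ρb N z x)⁻¹ • mb N z x; let θb := fun (N : ℕ) (z : Literature.Analysis.FluidPDE.Config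 (N + 1) (Fin 3) (UnitAddTorus (Fin 3))) (x : (UnitAddTorus (Fin 3))) => 2 / 3 * (Eb N z x / ρb N z x - ‖mb N z x‖ ^ 2 / (2 * ρb N z x ^ 2)); let pc := fun (r th : ℝ) => Literature.MathematicalPhysics.KineticTheory.hsPressure σ r th - r * th; ∀ t : ℝ, 0 < t → ∀ (ψ : ℝ → (UnitAddTorus (Fin 3)) → (EuclideanSpace ℝ (Fin 3))) (χ : ℝ → (UnitAddTorus (Fin 3)) → ℝ), Literature.Analysis.FunctionSpaces.Torus.IsSmoothSpaceTimeOn (Icc 0 t) ψ → Literature.Analysis.FunctionSpaces.Torus.IsSmoothSpaceTimeOn (Icc 0 t) χ → let O := fun (N : ℕ) (s : ℝ) (z : Literature.Analysis.FluidPDE.Config (N + 1) (Fin 3) (UnitAddTorus (Fin 3))) => ∫ y, ((∑ j, ψ s y.1 j * y.2 j) + χ s y.1 * (‖y.2‖ ^ 2 / 2)) ∂(Literature.Analysis.FluidPDE.empiricalMeasure z); let Cc := fun (N : ℕ) (z : Literature.Analysis.FluidPDE.Config (N + 1) (Fin 3) (UnitAddTorus (Fin 3))) (τ : ℝ) =>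 O N τ ((Φ N).flow τ z) - O N 0 ((Φ N).flow 0 z) - ∫ s in Icc 0 τ, ((∫ y, ((∑ j, Literature.Analysis.FunctionSpaces.Torus.timeDeriv ψ s y.1 j * y.2 j) + Literature.Analysis.FunctionSpaces.Torus.timeDeriv χ s y.1 * (‖y.2‖ ^ 2 / 2)) ∂(Literature.Analysis.FluidPDE.empiricalMeasure ((Φ N).flow s z))) + deriv (fun r : ℝ => O N s (Literature.Analysis.FluidPDE.freeFlight (Literature.Analysis.FluidPDE.Torus.geometry (Fin 3)) r ((Φ N).flow s z))) 0); ∀ δ : ℝ, 0 < δ → Tendsto (fun N : ℕ => Literature.MathematicalPhysics.KineticTheory.localGibbsLaw σ a₀ u₀ θ₀ N (Φ N) {z | ∃ τ ∈ Icc 0 t, δ < |Cc N z τ - ∫ s in Icc 0 τ, ∫ x, (Literature.Analysis.FunctionSpaces.Torus.divergence (ψ s) x + ∑ j, Literature.Analysis.FunctionSpaces.Torus.gradient (χ s) x j * ub N ((Φ N).flow s z) x j) * pc (ρb N ((Φ N).flow s z) x) (θb N ((Φ N).flow s z) x)|}) atTop (𝓝 0)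

/-- The crux is `∀ positive continuous profiles ∃ σ₀ ∀ σ < σ₀ ∀ Φ, ConclusionFor σ a₀ θ₀ u₀ Φ` (definitional
unfolding; cf. `Disproof.crux_iff`). [folklore] -/
theorem crux_iff :
    Summit.AtomisticToContinuum.HydrodynamicLimit.Theses.CollisionIsometryCLT.CollisionalTransferLocality ↔
      ∀ (a₀ θ₀ : T3 → ℝ) (u₀ : T3 → V3), Continuous a₀ → Continuous θ₀ → Continuous u₀ → (∀ x, 0 < a₀ x) →
        (∀ x, 0 < θ₀ x) → ∃ σ₀ : ℝ, 0 < σ₀ ∧ ∀ σ : ℝ, 0 < σ → σ < σ₀ → ∀ Φ : Flows σ,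
          ConclusionFor σ a₀ θ₀ u₀ Φ :=
  Iff.rfl

/-! ## Registered stubs (the ONLY `sorry`s of the line) -/

/-- **STUB (K) — `stub_momentChaos` (XL; the dynamical BET, shared with the route engine 12949 and with the
sibling lines' C⁺).** For all nice profiles, below a threshold in `σ`, for every flow family: velocity moments
of orders 2 and 3, weighted by any continuous compactly supported function of the blown-up relative positions
of an `m`-tuple of neighbours (contact shell included) and any macroscopic localisation, are centred-Maxwellian
at the block temperature, time-integrated, in probability (`MomentChaosAt`). Exactly true under the invariant
Gibbs law (positions ⫫ i.i.d. Maxwellian velocities); false at `σ = 0` like the kinetic target 9522, of which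
the `m = 0` order-2 instance is the block-traceless-stress half — so this is dynamical local equilibrium of
velocity MOMENTS ≤ 3 at the contact scale, the same hidden input as `AdaptedWeightCLT` (triage X1: not an
identity of the transfer isometry). Why it might fail: an `O(1)` configuration-dependent velocity covariance at
fixed `σ` (e.g. a uniaxial rattler-cage covariance) would survive; no N-uniform non-equilibrium estimate is
known (BoltzmannHypothesisBarrierNarrow: absence of proof). Cheapest falsifier: EDMD two-temperature / shear
relaxation, shell-conditioned cross-covariance against the unconditional traceless stress.
Sources: OllaVaradhanYau1993 §4 (B); FritzFunakiLebowitz1994 Thm 1; Spohn1991 Part I §3.2. [folklore] -/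
theorem stub_momentChaos :
    ∀ (a₀ θ₀ : T3 → ℝ) (u₀ : T3 → V3), NiceProfiles a₀ θ₀ u₀ → ∃ σ₀ : ℝ, 0 < σ₀ ∧ ∀ σ : ℝ, 0 < σ → σ < σ₀ →
      ∀ Φ : Flows σ, MomentChaosAt σ a₀ θ₀ u₀ Φ := by
  sorry

/-- **STUB — `stub_microstructureBounds` (L; a-priori bounds along the flow; the crux STANDS ALONE and may not
borrow `AprioriBounds (ii)`, Disproof.lean §1; triage X2: the `O(N)` entropy budget does not give contact-scale
configurational bounds — rattler-cage family `cage_entropy.py`).** For every density ceiling `η₁ > 0` and all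
nice profiles there is `σ₀` such that for `σ < σ₀` and every flow family `MicroBoundsAt σ η₁` holds: (B0) block
chamber `c₁ ≤ ρ̄`, `ρ̄σ³ ≤ η₁` on `[0, t]` w.h.p. (stronger than 9519 (ii)'s `≤ 1`, re-derived not borrowed;
plausible for `σ₀ = σ₀(η₁, profiles, t)` since the Euler solution's density stays bounded on `[0, t]` and
`ρ̄σ³ ≤ (sup ρ) σ₀³`); (B1) bounded time-integrated 6th velocity moment; (B2) bounded particle average of the
squared cumulative transfer `X_i²` — the uniform-integrability input of the Ward identities and of the read-out;
(B3) TWO-BLOCK PURITY — no density structure between the microscopic scale `(N+1)^{-1/3}` and the block scale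
`(N+1)^{-γ}` (the load-bearing residual: an activity MIXTURE of Gibbs states passes every other step and gives
`⟨p_c(ρ_micro)⟩ > p_c(ρ̄)` by convexity). NOT needed here (triage r1-2/r1-3 Ruelle-quality objection,
answered): any Gibbs-quality bound on time-averaged n-point densities — the rigidity is applied to Gibbs
states, and the competitor enters only through the deterministic packing box bound. Why it might fail: after
shocks, volume-filling sub-block vorticity (triage r1-2 remark 3) would break (B3) on a set of positive measure;
(B0) fails for focusing flows reaching `ρσ³ = η₁`. Sources: OllaVaradhanYau1993 Lemma 4.1, 4.9–4.10;
KipnisLandim1999; Sideris1985. [folklore] -/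
theorem stub_microstructureBounds :
    ∀ η₁ : ℝ, 0 < η₁ → ∀ (a₀ θ₀ : T3 → ℝ) (u₀ : T3 → V3), NiceProfiles a₀ θ₀ u₀ → ∃ σ₀ : ℝ, 0 < σ₀ ∧
      ∀ σ : ℝ, 0 < σ → σ < σ₀ → ∀ Φ : Flows σ, MicroBoundsAt σ η₁ a₀ θ₀ u₀ Φ := by
  sorry

/-- **STUB — `stub_wardBGY` (M/L; NEW — the card's lever; threshold-free).** Two-scale Ward identities are
free, and with (K) they ARE the weak hard-core BGY hierarchy: for `0 < σ < 1/2`, every flow family satisfying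
`MomentChaosAt` and `MicroBoundsAt σ η₁` (any `η₁`) satisfies `WeakBGYAt`. Proof route (all finite-`N`, on the
good set of the flow): (1) for the mixed observable `A(z) = (N+1)⁻¹ Σ_i Σ_j χ(x_i) F(Y_{ij}) (v_i·e)`
(resp. `(v_{j_k}·e)`), the balance law `HardSphereFlow.sub_eq_integral_add_collisionalTransfer` gives
`[A]₀^τ = ∫₀^τ Σ_i Σ_j χ ∇F·(N+1)^{1/3}(v_j − v_i)(v·e) + Σ_collisions ΔA`, left side `O(1)` by packing
(`≤ C^n` tuples per root) and (B1); (2) the jump of `v_i·e` at a collision of the root with an outsider `p` is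
`|g·ω̂|(ω̂·e)`, `ω̂ = unit(x_i − x_p)` (`inner_reflectVel_fst_sub_snd`; cf. `CollisionJumpPairShell`), insiders
never collide on `tsupport F`; (3) FLUX = TRACE: `Σ_{collisions in ds} B = (εh)⁻¹ ∫ Σ_{shell_h, incoming} |g·ω̂| B ds
+ O(h)` uniformly in `N` by (B2), so the collision term is `(hσ)⁻¹ ∫ Σ_shell (g·ω̂)₋² (ω̂·e) F`; (4) IN/OUT
SYMMETRY of a shell passage (`|g′·ω̂| = |g·ω̂|`, free flight symmetric about closest approach):
`(g·ω̂)₋² ↦ ½ (g·ω̂)²` up to `O(h)` third-body interruptions; (5) (K) order 2 with the weights `∇F` and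
`F·1_shell·(ω̂·e)` (sandwiched by continuous weights): streaming `→ θ̄ (N+1)^{1/3} (−Σ_k ∂_{k,e}F)` resp.
`θ̄ (N+1)^{1/3} ∂_{k,e}F` (`Σ_k ∇_k` of a function of differences vanishes, killing the `ū ū` part), shell term
`→ θ̄ (N+1)^{1/3} (hσ)⁻¹ Σ_shell F (ω̂·e)`; the order-1 (`ū`-linear) streaming piece is a total time derivative
of `F(Y(s))` against block fields varying at rate `≤ C(N+1)^{4γ} ≪ (N+1)^{1/3}` — integrate by parts in `s`;
(6) divide by `(N+1)^{1/3}`. Why it might fail: only through the error terms — a positive time-fraction of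
multi-body shell interference (jammed micro-clusters) not priced by (B2). Sources: Spohn1991 Part I §3.2;
IrvingKirkwood1950; GenoveseSimonella2012 §2 (stationary hard-sphere BBGKY ⇒ BGY under Maxwellian factorisation);
OllaVaradhanYau1993 §4 (C). [folklore] -/
theorem stub_wardBGY :
    ∀ η₁ : ℝ, 0 < η₁ → ∀ (a₀ θ₀ : T3 → ℝ) (u₀ : T3 → V3), NiceProfiles a₀ θ₀ u₀ → ∀ σ : ℝ, 0 < σ → σ < 2⁻¹ →
      ∀ Φ : Flows σ, MomentChaosAt σ a₀ θ₀ u₀ Φ → MicroBoundsAt σ η₁ a₀ θ₀ u₀ Φ → WeakBGYAt σ a₀ θ₀ u₀ Φ := by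
  sorry

/-- **STUB R — `stub_hardCoreBGYUniqueness` (L/XL; STATICS; the line-specific hardest stub: the hard-core case
of Gurevich–Suhov is "the only relevant case left open", GenoveseSimonella2012).** There is `η_R > 0` such that
`HardCoreBGYUniqueness η_R`. Intended proof: (i) realizability + box bounds ⇒ `dens⁻¹ g` is the factorial-moment
family of a point process `Q⁰` on `ℝ³` (tightness + determinacy under `ξ^{n+1}` growth); re-rooting invariance +
symmetry ⇒ `Q⁰` is the Palm measure of a STATIONARY hard-core point process `P` of intensity `dens`
(Mecke's characterisation); (ii) weak BGY for all `n` (root and particle variables) ⇒ the classical KMS /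
canonical-DLR condition: conditionally on the outside and on the particle number, the configuration in a
bounded window is UNIFORM on the admissible set (GallavottiVerboven1975, AizenmanEtAl1977 for smooth and
superstable pair potentials; hard cores by BV-regularity of `ρ_n` on the open admissible set, whose
distributional gradient BGY identifies as a boundary measure — the step not in print); (iii) canonical DLR +
stationarity ⇒ `P = ∫ Gibbs_z λ(dz)` (Georgii1979, extremal canonical Gibbs measures are grand-canonical); low
density everywhere ⇒ `λ` charges only `z` below the Kirkwood–Salsburg radius, where `Gibbs_z` is unique,
translation-invariant and mixing (Ruelle1969 Thm 4.2.3: `‖zK‖ < 1` on `E_ξ`); (iv) purity (Palm LLN, liminf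
form) ⇒ `λ = δ_{z(dens)}`; hence both families equal the Gibbs family at `z(dens)`. `η_R` absorbs the packing
constant (any finite `ξ` is allowed because uniqueness is used among GIBBS states only). Why it might fail: a
stationary non-Gibbs hard-core process whose correlation functions nevertheless satisfy every weak BGY
identity (a measure charging exact-contact or caged configurations in a way the thin-shell limits do not see);
cheapest falsifier: `d = 1` hard rods (Tonks), where every object is explicit. Sources: GurevichSuhov1976;
GallavottiVerboven1975; AizenmanEtAl1977; Georgii1979; Ruelle1969 Thm 4.2.3; GenoveseSimonella2012. [folklore] -/
theorem stub_hardCoreBGYUniqueness : ∃ ηR : ℝ, 0 < ηR ∧ HardCoreBGYUniqueness ηR := by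
  sorry

/-- **STUB E — `stub_gibbsFamilyEOS` (L; STATICS; carries the (X3) debt of every rigidity line: the pressure
equation for the TREE's `Z`).** There is `η_E > 0` such that `GibbsFamilyEOS η_E`: at density `dens`,
`dens σ³ < η_E`, the infinite-volume hard-sphere Gibbs correlation functions (Kirkwood–Salsburg fixed point at
the activity `z(dens)`, Ruelle1969 Thm 4.2.3; `ρ_n ≤ ξ^n`, analytic, cluster property) define a hard-core BGY
family (`g n := ρ_{n+1}(0, ·)`: BGY from DLR with continuous cavity functions; purity from mixing; realizable as
the limit of finite-volume Gibbs clouds seen from a typical particle), and its contact value satisfies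
`4π η g(σ⁺) = 6 (Z(η) − 1)`, `η = dens σ³`, with `Z = hsCompressibility = 1 + η · deriv hsExcessFreeEnergy η`:
the virial/pressure equation `βP/ρ = 1 + (2π/3) η g(σ⁺)` for the grand-canonical pressure (Presutti1975 gives
the mechanical definition), existence of the thermodynamic limit of the torus free volume and ensemble
equivalence (Ruelle1969 §3.4), differentiability of `f_ex` on `(0, η_E)` (LebowitzPenrose1964 / Ruelle1969 §4.3:
convergent virial expansion; `HsEosLowDensity` stmt-0768 territory), so that the thin-shell intensity per unit
volume is `dens · 6(Z − 1) · Ḡ`. Cheapest check: second virial coefficient, `6(Z − 1) = 4πη + O(η²)` against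
the ideal shell count `4πη h`. Why it might fail: only by a normalisation slip between the tree's `hsFreeVolume`
(`N` spheres at `n d³ = η`) and `dens σ³` — checked: `(N+1) ρ̄ ε³ = ρ̄ σ³`. Sources: Ruelle1969 Thm 4.2.3, §3.4,
§4.3; LebowitzPenrose1964; Presutti1975; Spohn1991 Part I (3.15). [folklore] -/
theorem stub_gibbsFamilyEOS : ∃ ηE : ℝ, 0 < ηE ∧ GibbsFamilyEOS ηE := by
  sorry

/-- **STUB — `stub_bgyPassage` (L/XL; the apparatus of the line; threshold-free given its inputs).** Given
uniqueness below `η_R`, the Gibbs family with its EOS below `η_E`, and a ceiling `η₁ < min η_R η_E`: for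
`0 < σ < 1/2` and every flow family, `MomentChaosAt ∧ MicroBoundsAt σ η₁ ∧ WeakBGYAt ⇒ GibbsContactTraceAt`.
Intended proof: (S1) space–time blow-ups: the time-integrated, `χ`-localised, root-averaged blown-up empirical
reduced correlation measures are tight (packing) and, along subsequences, converge to a Young measure
`(s, x) ↦ g^{s,x}` of reduced families (disintegration in `(s, x)`; deterministic, free); (S2) for a.e. `(s, x)`
with `θ̄(s,x) > 0`, `g^{s,x}` is a hard-core BGY family at density `ρ̄(s, x)` with the PACKING box constant:
measurability/nonnegativity/box bound/symmetry/re-rooting/hard core by construction, realizability because each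
fibre is a limit of mixtures of finite clouds (diagonal argument, vague topology metrisable on bounded sets),
density and purity from two-block purity (B3) + chamber (B0) (Fatou gives the liminf form), weak BGY in root
and particle variables from `WeakBGYAt` divided by `θ̄` (limits `N → ∞` then `h → 0`, UI from (B1)–(B2));
(S3) R + E: `g^{s,x} =` the Gibbs family at `ρ̄(s,x)` a.e., so its thin-shell contact functional is
`ρ̄ · 6(Z(ρ̄σ³) − 1) · Ḡ`, isotropic; (S4) back to finite `N` with velocity weights: in/out symmetry turns
`(g·ω̂)₋²` into `½(g·ω̂)²`, (K) order 2 evaluates it to `θ̄` against the configurational shell weight (trace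
part, `Ḡ(ū)` continuous in the block velocity), (K) order 3 kills the odd statistic; where `θ̄ = 0` both sides
vanish. No classification of stationary velocity LAWS (BoltzmannHypothesisBarrier: not in class — moments ≤ 3
and configurational rigidity only); no density or collision-tree expansion (NoDensityExpansion / DiluteRegime:
not in class; the only series is Kirkwood–Salsburg's convergent static one inside R/E). Why it might fail: the
interchange `N → ∞` / `h → 0` for fibres charging near-contact configurations anomalously (sticky
micro-clusters with zero thin-shell flux), i.e. a UI gap not covered by (B2). Sources: OllaVaradhanYau1993 §4
Lemma 4.1; Spohn1991 Part I §3.2; Ruelle1969 §4.2. [folklore] -/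
theorem stub_bgyPassage :
    ∀ (ηR ηE η₁ : ℝ), HardCoreBGYUniqueness ηR → GibbsFamilyEOS ηE → 0 < η₁ → η₁ < ηR → η₁ < ηE →
      ∀ (a₀ θ₀ : T3 → ℝ) (u₀ : T3 → V3), NiceProfiles a₀ θ₀ u₀ → ∀ σ : ℝ, 0 < σ → σ < 2⁻¹ → ∀ Φ : Flows σ,
        MomentChaosAt σ a₀ θ₀ u₀ Φ → MicroBoundsAt σ η₁ a₀ θ₀ u₀ Φ → WeakBGYAt σ a₀ θ₀ u₀ Φ →
          GibbsContactTraceAt σ a₀ θ₀ u₀ Φ := by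
  sorry

/-- **STUB — `stub_contactReadout` (L; contact read-out, with the Irving–Kirkwood identity proved inside).**
For `0 < σ < 1/2`, nice profiles, any ceiling `η₁ > 0` and every flow family: `GibbsContactTraceAt ∧
MicroBoundsAt σ η₁ ⇒ ConclusionFor` (the crux at `(σ, Φ)`). Content: (i) IRVING–KIRKWOOD IDENTITY (M,
provable now): on the good set of the flow (Liouville-conull, `localGibbsLaw ≪ liouville`) the residual `Cc(τ)`
of the route decl IS the finite sum over collision times in `(0, τ]` of the jumps of the frozen-time observable
`O(s, ·)` (`IsHardSphereTrajectory.sub_eq_integral_add_finsum_collisionJump_td` with `F s z := O(s, z)` after a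
smooth cut-off of `(ψ, χ)` outside `[0, t]`; `timeDeriv` junk only at `s ∈ {0, t}`), the jumps being
`(N+1)⁻¹[(ψ(x_i) − ψ(x_j))·Δv_i + (χ(x_i) − χ(x_j)) Δ|v_i|²/2]` (`collisionJump_momentumObservable` /
`_energyObservable`); (ii) FLUX = TRACE (as in `stub_wardBGY` (3)), uniformly in `N` by (B2); (iii) kinematics
`Δv_i = −(g·ω̂)ω̂`, `Δ|v_i|²/2 = −(g·ω̂)(ω̂·V_cm)`, `V_cm = ū + (ṽ_i + ṽ_j)/2`, midpoint Taylor
`ψ_s(x_i) − ψ_s(x_j) = ε (ω̂·∇)ψ_s + O(ε²)` with `ε Σ 1 = O(1)`, so the jump sum is `h⁻¹ ∫ TrStat` with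
`G = ½ ω̂⊗ω̂ : ∇ψ_s(x_i)` resp. `½ (ω̂·ū)(ω̂·∇χ_s)`, plus the odd statistic, plus `o(1)` (Riemann sums in `s`);
(iv) evaluation `Ḡ = div ψ / 6` resp. `ū·∇χ / 6`, so the limit is `∫∫ ρ̄ θ̄ (Z(ρ̄σ³) − 1)(div ψ + ū·∇χ) =
∫∫ (div ψ + ∇χ·ū) p_c(ρ̄, θ̄)` since `p_c = hsPressure σ ρ θ − ρ θ = ρθ(Z(ρσ³) − 1)` definitionally; the odd part
is the vanishing collisional heat flux; (v) `sup_{τ ≤ t}`: both sides have increments controlled by (B1)–(B2) on a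
`δ`-grid of `[0, t]`; empty/jammed-block junk excluded by (B0). Hemisphere constants as verified in triage
(`hemi_check.out`). Sources: IrvingKirkwood1950; Spohn1991 Part I §3.2 (3.3)–(3.8), (3.15); ChapmanCowling1970 §16.4. [folklore] -/
theorem stub_contactReadout :
    ∀ η₁ : ℝ, 0 < η₁ → ∀ (a₀ θ₀ : T3 → ℝ) (u₀ : T3 → V3), NiceProfiles a₀ θ₀ u₀ → ∀ σ : ℝ, 0 < σ → σ < 2⁻¹ →
      ∀ Φ : Flows σ, GibbsContactTraceAt σ a₀ θ₀ u₀ Φ → MicroBoundsAt σ η₁ a₀ θ₀ u₀ Φ →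
        ConclusionFor σ a₀ θ₀ u₀ Φ := by
  sorry

/-! ## Composition (sorry-free modulo the seven stubs) -/

/-- **The line's composition.** `η₁ := min η_R η_E / 2`; `σ₀ := min (min σ_K σ_B) 2⁻¹` with `σ_K`, `σ_B` the
thresholds of (K) and of the bounds at ceiling `η₁`; at `(σ, Φ)`: read-out ∘ (passage ∘ (K, bounds,
Ward/BGY ∘ (K, bounds)), bounds). Concludes the crux BY NAME. [folklore] -/
theorem CollisionalTransferLocality_of :
    Summit.AtomisticToContinuum.HydrodynamicLimit.Theses.CollisionIsometryCLT.CollisionalTransferLocality := by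
  obtain ⟨ηR, hηR, hR⟩ := stub_hardCoreBGYUniqueness
  obtain ⟨ηE, hηE, hE⟩ := stub_gibbsFamilyEOS
  have hm : 0 < min ηR ηE := lt_min hηR hηE
  have hη₁ : 0 < min ηR ηE / 2 := half_pos hm
  have hη₁R : min ηR ηE / 2 < ηR := (half_lt_self hm).trans_le (min_le_left _ _)
  have hη₁E : min ηR ηE / 2 < ηE := (half_lt_self hm).trans_le (min_le_right _ _)
  intro a₀ θ₀ u₀ ha hθ hu ha0 hθ0
  have hP : NiceProfiles a₀ θ₀ u₀ := ⟨ha, hθ, hu, ha0, hθ0⟩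
  obtain ⟨σ₁, hσ₁, H1⟩ := stub_momentChaos a₀ θ₀ u₀ hP
  obtain ⟨σ₂, hσ₂, H2⟩ := stub_microstructureBounds (min ηR ηE / 2) hη₁ a₀ θ₀ u₀ hP
  refine ⟨min (min σ₁ σ₂) 2⁻¹, lt_min (lt_min hσ₁ hσ₂) (by norm_num), fun σ hσ hσlt Φ => ?_⟩
  have h1 : σ < σ₁ := lt_of_lt_of_le hσlt ((min_le_left _ _).trans (min_le_left _ _))
  have h2 : σ < σ₂ := lt_of_lt_of_le hσlt ((min_le_left _ _).trans (min_le_right _ _))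
  have h3 : σ < 2⁻¹ := lt_of_lt_of_le hσlt (min_le_right _ _)
  have hK : MomentChaosAt σ a₀ θ₀ u₀ Φ := H1 σ hσ h1 Φ
  have hB : MicroBoundsAt σ (min ηR ηE / 2) a₀ θ₀ u₀ Φ := H2 σ hσ h2 Φ
  have hW : WeakBGYAt σ a₀ θ₀ u₀ Φ := stub_wardBGY _ hη₁ a₀ θ₀ u₀ hP σ hσ h3 Φ hK hB
  have hG : GibbsContactTraceAt σ a₀ θ₀ u₀ Φ :=
    stub_bgyPassage ηR ηE _ hR hE hη₁ hη₁R hη₁E a₀ θ₀ u₀ hP σ hσ h3 Φ hK hB hW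
  exact stub_contactReadout _ hη₁ a₀ θ₀ u₀ hP σ hσ h3 Φ hG hB

/-- The same composition read against the `StiffCollisionalRelaxation` copy of the shared item (one term,
`Disproof.shared_verbatim`). [folklore] -/
theorem CollisionalTransferLocality_of' :
    Summit.AtomisticToContinuum.HydrodynamicLimit.Theses.StiffCollisionalRelaxation.CollisionalTransferLocality :=
  CollisionalTransferLocality_of

end Summit.AtomisticToContinuum.HydrodynamicLimit.Cruxes.CollisionalTransferLocality.WardBgyContactRigidity

end
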